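import Mathlib
import Literature.NumberTheory.LFunctions.Zhang2022.Section17Eq172Shift
import Literature.NumberTheory.LFunctions.Zhang2022.Section13ConjugateAFE
import HarnessLib

/-!
# Zhang (2022) §17 (17.7), first half: "Moving the segment `𝔍(−α)` to `𝔍(−1)`" for the reflected
# integrand `𝔨₃*(s,ψ)ω(s)`, `ψ ∈ Ψ₁` — an edge from Proposition 2.2 (i)

Topic `Literature/NumberTheory/LFunctions/Zhang2022` (Landau–Siegel audit tree; verdict-neutral).
Y. Zhang, *Discrete mean estimates and the Landau–Siegel zero*, arXiv:2211.02515v1 (2022)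
[Zhang2022LandauSiegel] — **an unrefereed manuscript under adjudication**; nothing here asserts or
denies its Theorems 1–2. DAG node `Z22:(17.7)` [Z22 p.97, (17.7), tex L4785–L4789]:

> "Moving the segment `𝔍(−α)` to `𝔍(−1)` and then extend the sum over `Ψ₁` to the sum over `Ψ` we
> obtain `Σ_{ψ∈Ψ₁}(p_ψt₀)^{β₃}I₃⁻(ψ) = Σ_{p∼P}(pt₀)^{β₂}Φ₃⁻(p) + o(𝔓)`" (17.7)
> (after §17.u011: "`Σ_{ψ∈Ψ₁}(p_ψt₀)^{β₃}I₄⁻(ψ) = Σ_{ψ∈Ψ₁}(p_ψt₀)^{β₂}(1/2πi)∫_{𝔍(−α)}𝔨₃*(s,ψ)ω(s)ds + o(𝔓)`",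
> `𝔨₃*(s,ψ) = (L(1−s−β₁,ψ̄)/L(1−s,ψ̄))F(1−s,ψ̄)B(s,ψ)G(s,ψ)N(s+β₂,ψ)N(s+β₃,ψ)`, §17.u012).

This file proves the FIRST of the two moves of (17.7), with the error `O(ε)`, `ε = e^{−𝓛¹⁰/16}`:
`eq17_7a_of_prop22i : Skeleton.Prop22i → ∀ c′, ∃ c > 0, ∃ C, ForAllLarge ((A) →
‖Σ_{ψ∈Ψ₁}(p_ψt₀)^{β₂}(1/2πi)∫_{𝔍(−α)}𝔨₃*ω − Σ_{ψ∈Ψ₁}(p_ψt₀)^{β₂}(1/2πi)∫_{𝔍(−1)}𝔨₃*ω‖ ≤ C·e^{−c𝓛¹⁰})`,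
the left sum spelled exactly as the right side of `Typed.Section17.Step17_u011`, the right one with
the `𝔍(−1)` integrals of `Typed.Section17.Phi3minus`. It is the LEFT twin of the first half of (17.2)
(`Eq172.eq17_2a_of_prop22i`, file `Section17Eq172Shift`; both are §17 twins of the tree's §8.u016
`Step8u016.step8u016_of`), on the rectangle `[−½, ½−α] × [2πt₀−𝓛₁, 2πt₀+𝓛₁]`:
* holomorphy (`differentiableOn_kfrak3Star_omega`): by the reflection `L(w,ψ̄) = conj L(w̄,ψ)`
  (`LFunction_inv_conj`, `Section13ConjugateAFE`) the denominator `L(1−s,ψ̄)` is `conj L(1−s̄,ψ)` with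
  `Re(1−s̄) ∈ [½+α, 3/2]`, non-zero "by Proposition 2.2" (i) (`Step8u016.LFunction_ne_zero_of_onLine`);
  the numerator `L(1−s−β₁,ψ̄)F(1−s,ψ̄)BGNNω` is entire;
* the horizontal sides (`norm_kfrak3Star_omega_le`, `_uniform`): `|L(1−s−β₁,ψ̄)| = |L(1−s̄+β₁,ψ)| ≤
  p(|t|+5)Z`, `|L(1−s,ψ̄)|⁻¹ = |L(1−s̄,ψ)|⁻¹ ≤ e^{C(1+log(1/α))(log p + log(|t|+4))}`
  (`DirichletDisc.exp_neg_le_norm_LFunction`, disc zeros on the line at distance `≥ α` from `[1−σ, 2]`),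
  `|F(1−s,ψ̄)| ≤ D⁸` (`Re(1−s) ≥ ½`), and the trivial bounds ON `Re s ≥ −1` (new here, the only point
  where the left rectangle differs): `|B| ≤ (1+|ι₂|)(|ι₃|+|ι₄|)(P+1)⁴`, `|G| ≤ D¹²`, `|N(s+β_j)| ≤ (P+1)²`
  (`|n^{−s}| ≤ n`); the Gaussian `≤ 6e^{−𝓛¹⁰/4}`; uniformly `≤ K·P¹²·e^{3C𝓛⁹(1+9log𝓛)}e^{−𝓛¹⁰/4}`;
* Cauchy per `ψ` (`Section7aStatements.norm_intJ_sub_intJ_le` with `z₁ = −1`, `z₂ = −α`),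
  `|(p_ψt₀)^{β₂}| = 1`, `#Ψ₁ ≤ 𝔓 ≤ 4P²`, `Step8u016.growth_le`.

Theorems only; no definitions, no named facts; axioms standard. ZHANG-L discharge lane (WP16; seat
zl-w16-p7 as helper of zl-w16-p3 under the leaf `Typed.Section17.Eq17_9Rel`: (17.7) = §17.u010
(tree `Typed.Section17.step17_u010_holds`) + u011 + THIS move + the `Ψ₁ → Ψ` extension).
WHAT THIS IS NOT: a proof of (17.7), nor any claim about Theorems 1–2 of the source or about
Landau–Siegel zeros.

## References

* Y. Zhang, arXiv:2211.02515v1 (2022), §17 (17.7) p.97 (tex L4770–L4789); §8 p.43 (tex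
  L2255–L2258, the same move for `I₁⁺`); §2 (2.13), (2.15). [cite: Zhang2022LandauSiegel, §17 (17.7) p.97]
* H. L. Montgomery, R. C. Vaughan, *Multiplicative Number Theory I* (2007), Lemma 10.15 / §11.1
  (the disc bounds behind `DirichletDisc`). [cite: MontgomeryVaughan2007, Lemma 10.15]
-/

noncomputable section

open Complex Real Set Metric MeasureTheory
open Literature.NumberTheory.LFunctions.Zhang2022.Skeleton
open Literature.NumberTheory.LFunctions.Zhang2022.Typed.Section17
open Literature.NumberTheory.LFunctions.Zhang2022.Section8aStatements (beta_eq_b_mul_I)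

namespace Literature.NumberTheory.LFunctions.Zhang2022.Eq177

/-! ## Trivial bounds for `B, G, N` on `Re s ≥ −1` -/

section TrivialLeft

variable {D : ℕ} (χ : DirichletCharacter ℂ D) (x : Chr D)

omit χ x in
/-- `|n^{−s}| ≤ n` for `n ≥ 1`, `Re s ≥ −1`. [folklore] -/
private theorem norm_natCast_cpow_neg_le_self {n : ℕ} (hn : 0 < n) {s : ℂ} (hs : -1 ≤ s.re) :
    ‖(n : ℂ) ^ (-s)‖ ≤ n := by
  rw [Complex.norm_natCast_cpow_of_pos hn]
  have h1 : (1 : ℝ) ≤ n := by exact_mod_cast hn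
  calc (n : ℝ) ^ (-s).re ≤ (n : ℝ) ^ (1 : ℝ) :=
        Real.rpow_le_rpow_of_exponent_le h1 (by simp only [neg_re]; linarith)
    _ = n := Real.rpow_one _

omit χ x in
/-- A Dirichlet polynomial `Σ_{n∈S} c(n)n^{−s}` over `1 ≤ n ≤ M`, `|c(n)| ≤ 1`, `Re s ≥ −1` is
`≤ #S·M`. [folklore] -/
private theorem norm_dirichletSum_le_card_mul {S : Finset ℕ} {M : ℝ} (hS : ∀ n ∈ S, 0 < n)
    (hM : ∀ n ∈ S, (n : ℝ) ≤ M) {c : ℕ → ℂ} (hc : ∀ n ∈ S, ‖c n‖ ≤ 1) {s : ℂ} (hs : -1 ≤ s.re) :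
    ‖∑ n ∈ S, c n * (n : ℂ) ^ (-s)‖ ≤ S.card * M := by
  calc ‖∑ n ∈ S, c n * (n : ℂ) ^ (-s)‖ ≤ ∑ n ∈ S, ‖c n * (n : ℂ) ^ (-s)‖ := norm_sum_le _ _
    _ ≤ ∑ n ∈ S, M := Finset.sum_le_sum fun n hn => by
        rw [norm_mul]
        calc ‖c n‖ * ‖(n : ℂ) ^ (-s)‖ ≤ 1 * n :=
              mul_le_mul (hc n hn) (norm_natCast_cpow_neg_le_self (hS n hn) hs) (norm_nonneg _)
                zero_le_one
          _ ≤ M := by rw [one_mul]; exact hM n hn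
    _ = S.card * M := by rw [Finset.sum_const, nsmul_eq_mul]

omit χ x in
/-- `#(Ico 1 ⌈y⌉) ≤ P + 1` and every member is `≤ P + 1`, for `0 ≤ y ≤ P`. [folklore] -/
private theorem Ico_ceil_sizes {y : ℝ} (hy : 0 ≤ y) (hyP : y ≤ bigP D) :
    ((Finset.Ico 1 ⌈y⌉₊).card : ℝ) ≤ bigP D + 1 ∧
      ∀ n ∈ Finset.Ico 1 ⌈y⌉₊, (n : ℝ) ≤ bigP D + 1 := by
  have h2 : (⌈y⌉₊ : ℝ) < y + 1 := Nat.ceil_lt_add_one hy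
  constructor
  · rw [Nat.card_Ico]
    have h1 : ((⌈y⌉₊ - 1 : ℕ) : ℝ) ≤ (⌈y⌉₊ : ℝ) := by exact_mod_cast Nat.sub_le _ _
    linarith
  · intro n hn
    have h3 : (n : ℝ) ≤ ⌈y⌉₊ := by exact_mod_cast (Finset.mem_Ico.mp hn).2.le
    linarith

/-- `|ψχ(n)| ≤ 1`. [cite: Zhang2022LandauSiegel, §2 (2.23)] -/
private theorem norm_pc_le_one' (n : ℕ) : ‖pc χ x n‖ ≤ 1 := by
  rw [pc, norm_mul]
  calc ‖x.ψ (n : ZMod x.p)‖ * ‖χ (n : ZMod D)‖ ≤ 1 * 1 :=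
        mul_le_mul (x.ψ.norm_le_one _) (χ.norm_le_one _) (norm_nonneg _) zero_le_one
    _ = 1 := mul_one _

omit χ x in
/-- `P₁, P₂, P₃ ≤ P` and `0 ≤ P₁, P₂, P₃`. [cite: Zhang2022LandauSiegel, §2 (2.21)–(2.22)] -/
private theorem P123_sizes (D : ℕ) :
    (0 ≤ Skeleton.P1 D ∧ Skeleton.P1 D ≤ bigP D) ∧ (0 ≤ Skeleton.P2 D ∧ Skeleton.P2 D ≤ bigP D) ∧
      (0 ≤ Skeleton.P3 D ∧ Skeleton.P3 D ≤ bigP D) := by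
  have hP1 : 1 ≤ bigP D := by
    rw [bigP]; exact Real.one_le_exp (pow_nonneg (Real.log_natCast_nonneg D) 9)
  have hP0 : 0 ≤ bigP D := by linarith
  have hT1 : 1 ≤ bigT D ^ 10 :=
    one_le_pow₀ (by rw [bigT]; exact Real.one_le_exp (Real.rpow_nonneg (Real.log_natCast_nonneg D) _))
  have hle : ∀ e : ℝ, e ≤ 1 → bigP D ^ e ≤ bigP D := fun e he => by
    have := Real.rpow_le_rpow_of_exponent_le hP1 he
    rwa [Real.rpow_one] at this
  refine ⟨⟨?_, ?_⟩, ⟨?_, ?_⟩, ⟨?_, ?_⟩⟩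
  · rw [Skeleton.P1]; exact Real.rpow_nonneg hP0 _
  · rw [Skeleton.P1]; exact hle _ (by norm_num)
  · rw [Skeleton.P2]; exact div_nonneg (Real.rpow_nonneg hP0 _) (by linarith)
  · rw [Skeleton.P2]; exact (div_le_self (Real.rpow_nonneg hP0 _) hT1).trans (hle _ (by norm_num))
  · rw [Skeleton.P3]; exact Real.rpow_nonneg hP0 _
  · rw [Skeleton.P3]; exact hle _ (by norm_num)

/-- `|H₁₂(s,ψ)|, |H₁₃(s,ψ)|, |H₁₄(s,ψ)| ≤ (P+1)²` for `Re s ≥ −1` (`|ϰ_j| ≤ 1`, `|ψχ| ≤ 1`, `|n^{−s}| ≤ n`,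
fewer than `P + 1` terms, each `n ≤ P + 1`). [cite: Zhang2022LandauSiegel, §2 (2.24)–(2.25); §12 (12.1)] -/
private theorem norm_H_le_left (hD : 2 ≤ Real.log D) {s : ℂ} (hs : -1 ≤ s.re) :
    ‖H12 χ x s‖ ≤ (bigP D + 1) ^ 2 ∧ ‖H13 χ x s‖ ≤ (bigP D + 1) ^ 2 ∧
      ‖H14 χ x s‖ ≤ (bigP D + 1) ^ 2 := by
  obtain ⟨⟨h10, h1P⟩, ⟨h20, h2P⟩, ⟨h30, h3P⟩⟩ := P123_sizes D
  obtain ⟨c2, m2⟩ := Ico_ceil_sizes (D := D) h20 h2P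
  obtain ⟨c3, m3⟩ := Ico_ceil_sizes (D := D) h30 h3P
  obtain ⟨c1, m1⟩ := Ico_ceil_sizes (D := D) h10 h1P
  have hP : 0 ≤ bigP D + 1 := by have := Real.exp_pos (ell D ^ 9); rw [bigP]; linarith
  refine ⟨?_, ?_, ?_⟩
  · rw [pow_two (bigP D + 1), H12]
    refine (norm_dirichletSum_le_card_mul (fun n hn => (Finset.mem_Ico.mp hn).1) m2
      (fun n _ => ?_) hs).trans (mul_le_mul_of_nonneg_right c2 hP)
    rw [norm_mul]
    calc ‖vk2 D n‖ * ‖pc χ x n‖ ≤ 1 * 1 :=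
          mul_le_mul (norm_vk2_le hD n) (norm_pc_le_one' χ x n) (norm_nonneg _) zero_le_one
      _ = 1 := mul_one _
  · rw [pow_two (bigP D + 1), H13]
    refine (norm_dirichletSum_le_card_mul (fun n hn => (Finset.mem_Ico.mp hn).1) m3
      (fun n _ => ?_) hs).trans (mul_le_mul_of_nonneg_right c3 hP)
    rw [norm_mul]
    calc ‖vk3 D n‖ * ‖pc χ x n‖ ≤ 1 * 1 :=
          mul_le_mul (norm_vk3_le hD n) (norm_pc_le_one' χ x n) (norm_nonneg _) zero_le_one
      _ = 1 := mul_one _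
  · rw [pow_two (bigP D + 1), H14]
    have hsub : (((Finset.Ico 1 ⌈Skeleton.P1 D⌉₊).filter
        (fun n : ℕ => (n : ℝ) < bigP D ^ (1 / 2 : ℝ))).card : ℝ) ≤
        (Finset.Ico 1 ⌈Skeleton.P1 D⌉₊).card := by
      exact_mod_cast Finset.card_filter_le _ _
    refine (norm_dirichletSum_le_card_mul
      (fun n hn => (Finset.mem_Ico.mp (Finset.mem_filter.mp hn).1).1)
      (fun n hn => m1 n (Finset.mem_filter.mp hn).1) (fun n _ => ?_) hs).trans
      (mul_le_mul_of_nonneg_right (hsub.trans c1) hP)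
    rw [norm_mul]
    calc ‖vk1 D n‖ * ‖pc χ x n‖ ≤ 1 * 1 :=
          mul_le_mul (norm_vk1_le hD n) (norm_pc_le_one' χ x n) (norm_nonneg _) zero_le_one
      _ = 1 := mul_one _

/-- **`|B(s,ψ)| ≤ (1+|ι₂|)(|ι₃|+|ι₄|)(P+1)⁴`** for `Re s ≥ −1` (trivial estimation of (12.2) to the left
of the critical line). [cite: Zhang2022LandauSiegel, §12 (12.2)] -/
theorem norm_Bpoly_le_left (hD : 2 ≤ Real.log D) {s : ℂ} (hs : -1 ≤ s.re) :
    ‖Bpoly χ x s‖ ≤ (1 + ‖iota2‖) * (‖iota3‖ + ‖iota4‖) * (bigP D + 1) ^ 4 := by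
  obtain ⟨h12, h13, h14⟩ := norm_H_le_left χ x hD hs
  have hP : 0 ≤ bigP D + 1 := by have := Real.exp_pos (ell D ^ 9); rw [bigP]; linarith
  have hA : ‖H14 χ x s + iota2 * H12 χ x s‖ ≤ (1 + ‖iota2‖) * (bigP D + 1) ^ 2 := by
    calc ‖H14 χ x s + iota2 * H12 χ x s‖ ≤ ‖H14 χ x s‖ + ‖iota2‖ * ‖H12 χ x s‖ := by
          rw [← norm_mul]; exact norm_add_le _ _
      _ ≤ (bigP D + 1) ^ 2 + ‖iota2‖ * (bigP D + 1) ^ 2 := by gcongr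
      _ = (1 + ‖iota2‖) * (bigP D + 1) ^ 2 := by ring
  have hB : ‖H2 χ x s‖ ≤ (‖iota3‖ + ‖iota4‖) * (bigP D + 1) ^ 2 := by
    rw [H2]
    calc ‖(starRingEnd ℂ) iota3 * H13 χ x s + (starRingEnd ℂ) iota4 * H12 χ x s‖
        ≤ ‖(starRingEnd ℂ) iota3‖ * ‖H13 χ x s‖ + ‖(starRingEnd ℂ) iota4‖ * ‖H12 χ x s‖ := by
          rw [← norm_mul, ← norm_mul]; exact norm_add_le _ _
      _ ≤ ‖iota3‖ * (bigP D + 1) ^ 2 + ‖iota4‖ * (bigP D + 1) ^ 2 := by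
          rw [Complex.norm_conj, Complex.norm_conj]; gcongr
      _ = (‖iota3‖ + ‖iota4‖) * (bigP D + 1) ^ 2 := by ring
  rw [Bpoly, norm_mul]
  calc ‖H14 χ x s + iota2 * H12 χ x s‖ * ‖H2 χ x s‖
      ≤ ((1 + ‖iota2‖) * (bigP D + 1) ^ 2) * ((‖iota3‖ + ‖iota4‖) * (bigP D + 1) ^ 2) :=
        mul_le_mul hA hB (norm_nonneg _) (by positivity)
    _ = (1 + ‖iota2‖) * (‖iota3‖ + ‖iota4‖) * (bigP D + 1) ^ 4 := by ring

/-- `|υ(n)| ≤ τ(n) ≤ n` (`υ = μ ∗ μχ`, (3.1), crude form). [cite: Zhang2022LandauSiegel, §3 (3.1)] -/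
private theorem norm_ups_le_self' (n : ℕ) : ‖ups χ n‖ ≤ n := by
  rw [ups, LSeries.convolution_def]
  calc ‖∑ p ∈ n.divisorsAntidiagonal, (ArithmeticFunction.moebius p.1 : ℂ) *
          ((ArithmeticFunction.moebius p.2 : ℂ) * χ (p.2 : ZMod D))‖
      ≤ ∑ p ∈ n.divisorsAntidiagonal, ‖(ArithmeticFunction.moebius p.1 : ℂ) *
          ((ArithmeticFunction.moebius p.2 : ℂ) * χ (p.2 : ZMod D))‖ := norm_sum_le _ _
    _ ≤ ∑ p ∈ n.divisorsAntidiagonal, (1 : ℝ) := Finset.sum_le_sum fun p _ => by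
        rw [norm_mul, norm_mul]
        have h1 : ‖(ArithmeticFunction.moebius p.1 : ℂ)‖ ≤ 1 := by
          rw [Complex.norm_intCast]; exact_mod_cast ArithmeticFunction.abs_moebius_le_one
        have h2 : ‖(ArithmeticFunction.moebius p.2 : ℂ)‖ ≤ 1 := by
          rw [Complex.norm_intCast]; exact_mod_cast ArithmeticFunction.abs_moebius_le_one
        calc ‖(ArithmeticFunction.moebius p.1 : ℂ)‖ * (‖(ArithmeticFunction.moebius p.2 : ℂ)‖ *
              ‖χ (p.2 : ZMod D)‖) ≤ 1 * (1 * 1) := by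
              gcongr
              exact χ.norm_le_one _
          _ = 1 := by ring
    _ = n.divisorsAntidiagonal.card := by simp
    _ = n.divisors.card := by rw [← Nat.map_div_right_divisors, Finset.card_map]
    _ ≤ n := by exact_mod_cast Nat.card_divisors_le_self n

/-- **`|G(s,ψ)| ≤ D¹²`** for `Re s ≥ −1` (`Σ_{n≤D⁴}|υ(n)|·n ≤ D⁴·D⁴·D⁴`).
[cite: Zhang2022LandauSiegel, §3 p. 6] -/
theorem norm_Gpoly_le_left {s : ℂ} (hs : -1 ≤ s.re) : ‖Gpoly χ x s‖ ≤ (D : ℝ) ^ 12 := by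
  unfold Gpoly
  have hterm : ∀ n ∈ Finset.Icc 1 (D ^ 4),
      ‖ups χ n * x.ψ (n : ZMod x.p) * (n : ℂ) ^ (-s)‖ ≤ ((D ^ 4 : ℕ) : ℝ) * ((D ^ 4 : ℕ) : ℝ) := by
    intro n hn
    obtain ⟨h1, h2⟩ := Finset.mem_Icc.mp hn
    have hn' : (n : ℝ) ≤ ((D ^ 4 : ℕ) : ℝ) := by exact_mod_cast h2
    calc ‖ups χ n * x.ψ (n : ZMod x.p) * (n : ℂ) ^ (-s)‖
        = ‖ups χ n‖ * ‖x.ψ (n : ZMod x.p)‖ * ‖(n : ℂ) ^ (-s)‖ := by rw [norm_mul, norm_mul]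
      _ ≤ n * 1 * n := by
          gcongr
          · exact norm_ups_le_self' χ n
          · exact x.ψ.norm_le_one _
          · exact norm_natCast_cpow_neg_le_self h1 hs
      _ ≤ ((D ^ 4 : ℕ) : ℝ) * 1 * ((D ^ 4 : ℕ) : ℝ) := by gcongr
      _ = ((D ^ 4 : ℕ) : ℝ) * ((D ^ 4 : ℕ) : ℝ) := by ring
  calc ‖∑ n ∈ Finset.Icc 1 (D ^ 4), ups χ n * x.ψ (n : ZMod x.p) * (n : ℂ) ^ (-s)‖
      ≤ ∑ n ∈ Finset.Icc 1 (D ^ 4), ‖ups χ n * x.ψ (n : ZMod x.p) * (n : ℂ) ^ (-s)‖ :=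
        norm_sum_le _ _
    _ ≤ ∑ n ∈ Finset.Icc 1 (D ^ 4), ((D ^ 4 : ℕ) : ℝ) * ((D ^ 4 : ℕ) : ℝ) := Finset.sum_le_sum hterm
    _ = (D : ℝ) ^ 12 := by
        rw [Finset.sum_const, Nat.card_Icc, nsmul_eq_mul]
        push_cast
        ring

omit χ in
/-- `|g*(y)| ≤ 1`. [cite: Zhang2022LandauSiegel, §6 p.30; §4 (4.1)] -/
private theorem norm_gstar_le_one'' (hℓ : 0 < ell D) (y : ℝ) : ‖(gstar D y : ℂ)‖ ≤ 1 := by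
  rw [Complex.norm_real, Real.norm_eq_abs, gstar]
  split_ifs
  · have h30 : 0 < ell D ^ 30 := by positivity
    rw [gW, abs_of_pos (GaussWeight.gWeight_pos h30 _)]
    exact (GaussWeight.gWeight_lt_one h30 _).le
  · simp

omit χ in
/-- **`|N(w,ψ)| ≤ (P+1)²`** for `Re w ≥ −1`, `𝓛 ≥ 3` (`< 2T² ≤ P` terms, each `≤ n ≤ P + 1`).
[cite: Zhang2022LandauSiegel, §6 Lemma 6.1] -/
theorem norm_Nchar_le_left (hL : 3 ≤ ell D) {w : ℂ} (hw : -1 ≤ w.re) :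
    ‖Nchar D (psiFn x) w‖ ≤ (bigP D + 1) ^ 2 := by
  have hℓ : 0 < ell D := by linarith
  have h : Nchar D (psiFn x) w = ∑ n ∈ Finset.Ico 1 ⌈2 * bigT D ^ 2⌉₊,
      (psiFn x n * (gstar D (bigT D ^ 2 / n) : ℂ)) * (n : ℂ) ^ (-w) := by
    rw [Nchar]; refine Finset.sum_congr rfl fun n _ => ?_; ring
  have hT0 : 0 ≤ 2 * bigT D ^ 2 := by rw [bigT]; positivity
  have hTP : 2 * bigT D ^ 2 ≤ bigP D := by
    -- `2T² ≤ P` for `𝓛 ≥ 3` (as in `Typed.Section17.norm_Nchar_le_trivial`)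
    have hL1 : 1 ≤ ell D := by linarith
    have h11 : ell D ^ (1.1 : ℝ) ≤ ell D ^ 2 := by
      have := Real.rpow_le_rpow_of_exponent_le hL1 (by norm_num : (1.1 : ℝ) ≤ 2)
      rwa [Real.rpow_two] at this
    have h9 : ell D ^ 9 = ell D ^ 2 * ell D ^ 7 := by ring
    have h7 : (3 : ℝ) ^ 7 ≤ ell D ^ 7 := pow_le_pow_left₀ (by norm_num) hL 7
    have hkey : Real.log 2 + 2 * ell D ^ (1.1 : ℝ) ≤ ell D ^ 9 := by
      rw [h9]; nlinarith [Real.log_two_lt_d9]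
    rw [bigT, bigP, ← Real.exp_nat_mul]
    have : (2 : ℝ) * Real.exp ((2 : ℕ) * ell D ^ (1.1 : ℝ)) =
        Real.exp (Real.log 2 + 2 * ell D ^ (1.1 : ℝ)) := by
      rw [Real.exp_add, Real.exp_log two_pos]; push_cast; ring
    rw [this]
    exact Real.exp_le_exp.mpr hkey
  obtain ⟨cT, mT⟩ := Ico_ceil_sizes (D := D) hT0 hTP
  have hP : 0 ≤ bigP D + 1 := by have := Real.exp_pos (ell D ^ 9); rw [bigP]; linarith
  rw [pow_two (bigP D + 1), h]
  refine (norm_dirichletSum_le_card_mul (fun n hn => (Finset.mem_Ico.mp hn).1) mT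
    (fun n _ => ?_) hw).trans (mul_le_mul_of_nonneg_right cT hP)
  rw [norm_mul]
  calc ‖psiFn x n‖ * ‖(gstar D (bigT D ^ 2 / n) : ℂ)‖ ≤ 1 * 1 :=
        mul_le_mul (x.ψ.norm_le_one _) (norm_gstar_le_one'' hℓ _) (norm_nonneg _) zero_le_one
    _ = 1 := mul_one _

end TrivialLeft

/-! ## Holomorphy of `𝔨₃*(s,ψ)ω(s)` on the rectangle `[−½, ½−α] × [2πt₀−𝓛₁, 2πt₀+𝓛₁]` -/

section Holomorphy

variable (c' : ℝ) {D : ℕ} [NeZero D] {χ : DirichletCharacter ℂ D} (x : Chr D)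

omit [NeZero D] in
/-- `𝔨₃*(s,ψ)ω(s) = G*(s)/L(1−s,ψ̄)` with the entire numerator
`G*(s) = L(1−s−β₁,ψ̄)F(1−s,ψ̄)B(s,ψ)G(s,ψ)N(s+β₂,ψ)N(s+β₃,ψ)ω(s)`. [cite: Zhang2022LandauSiegel, §17 u012 p.97] -/
theorem kfrak3Star_mul_omega_eq_div (s : ℂ) :
    kfrak3Star c' χ x s * omegaW D s =
      (DirichletCharacter.LFunction x.ψ⁻¹ (1 - s - beta1 c' D) * FpolyBar χ x (1 - s) *
        Bpoly χ x s * Gpoly χ x s * Nchar D (psiFn x) (s + beta2 c' D) *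
        Nchar D (psiFn x) (s + beta3 c' D) * omegaW D s) /
        DirichletCharacter.LFunction x.ψ⁻¹ (1 - s) := by
  simp only [kfrak3Star, div_eq_mul_inv]
  ring

omit [NeZero D] in
/-- The numerator `G*(s)` of `𝔨₃*(s,ψ)ω(s)` is entire (`L(·,ψ̄)` entire for the non-principal `ψ̄`;
`F, B, G, N` finite Dirichlet polynomials over `n ≥ 1`; `ω` a Gaussian).
[cite: Zhang2022LandauSiegel, §17 u012 p.97] -/
theorem differentiable_numerator3Star :
    Differentiable ℂ (fun z => DirichletCharacter.LFunction x.ψ⁻¹ (1 - z - beta1 c' D) *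
      FpolyBar χ x (1 - z) * Bpoly χ x z * Gpoly χ x z * Nchar D (psiFn x) (z + beta2 c' D) *
      Nchar D (psiFn x) (z + beta3 c' D) * omegaW D z) := by
  have hψ : x.ψ⁻¹ ≠ 1 := inv_ne_one.mpr x.ψ_ne_one
  have hL : Differentiable ℂ (DirichletCharacter.LFunction x.ψ⁻¹) :=
    DirichletCharacter.differentiable_LFunction hψ
  have h1 : Differentiable ℂ (fun z => DirichletCharacter.LFunction x.ψ⁻¹ (1 - z - beta1 c' D)) :=
    hL.comp (((differentiable_const _).sub differentiable_id).sub_const _)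
  have hF : Differentiable ℂ (fun z => FpolyBar χ x (1 - z)) :=
    (differentiable_FpolyBar' χ x).comp ((differentiable_const _).sub differentiable_id)
  have h2 : Differentiable ℂ (fun z => Nchar D (psiFn x) (z + beta2 c' D)) :=
    (differentiable_Nchar (psiFn x)).comp (differentiable_id.add_const _)
  have h3 : Differentiable ℂ (fun z => Nchar D (psiFn x) (z + beta3 c' D)) :=
    (differentiable_Nchar (psiFn x)).comp (differentiable_id.add_const _)
  exact (((((h1.mul hF).mul (differentiable_Bpoly χ x)).mul (differentiable_Gpoly χ x)).mul
    h2).mul h3).mul (Section8aStatements.differentiable_omegaW D)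

/-- **The integrand `𝔨₃*ω` is holomorphic on the closed rectangle `[−½, ½−α] × [2πt₀−𝓛₁, 2πt₀+𝓛₁]`**
for `ψ ∈ Ψ₁` (zeros of `L(s,ψ)L(s,ψχ)` in `Ω` on the line, `0 < α ≤ 1`): the numerator is entire and
`L(1−s,ψ̄) = conj L(1−s̄,ψ) ≠ 0` there since `Re(1−s̄) ∈ [½+α, 3/2]`.
[cite: Zhang2022LandauSiegel, §17 (17.7) p.97] -/
theorem differentiableOn_kfrak3Star_omega (h22 : ∀ s ∈ prodZeroSetOmega χ x, s.re = 1 / 2)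
    (hα0 : 0 < alpha D) (hα1 : alpha D ≤ 1) :
    DifferentiableOn ℂ (fun s => kfrak3Star c' χ x s * omegaW D s)
      (Set.uIcc (1 / 2 + -1) (1 / 2 + -alpha D) ×ℂ
        Set.uIcc (2 * π * t0 D - ell1 D) (2 * π * t0 D + ell1 D)) := by
  intro s hs
  have hre : 1 / 2 + -1 ≤ s.re ∧ s.re ≤ 1 / 2 + -alpha D := by
    have h := hs.1
    rw [Set.uIcc_of_le (by linarith)] at h
    exact h
  have hℓ1 : 0 ≤ ell1 D := pow_nonneg (Real.log_natCast_nonneg D) _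
  have him : 2 * π * t0 D - ell1 D ≤ s.im ∧ s.im ≤ 2 * π * t0 D + ell1 D := by
    have h := hs.2
    rw [Set.uIcc_of_le (by linarith)] at h
    exact h
  -- `L(1−s,ψ̄) = conj L(1 − s̄, ψ)`, and `1 − s̄` lies right of `σ = ½ + α` inside the window
  set w : ℂ := 1 - (starRingEnd ℂ) s with hw
  have hwre : w.re = 1 - s.re := by simp [hw]
  have hwim : w.im = s.im := by simp [hw]
  have himw : |w.im - 2 * π * t0 D| < ell1 D + 2 := by
    rw [hwim, abs_lt]; constructor <;> linarith
  have hLw : x.ψ.LFunction w ≠ 0 :=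
    Step8u016.LFunction_ne_zero_of_onLine h22 (by rw [hwre]; linarith) himw
  have hL : DirichletCharacter.LFunction x.ψ⁻¹ (1 - s) ≠ 0 := by
    rw [Typed.Section13.LFunction_inv_conj x (1 - s), map_sub, map_one]
    exact (map_ne_zero _).mpr hLw
  have hψ : x.ψ⁻¹ ≠ 1 := inv_ne_one.mpr x.ψ_ne_one
  have hden : Differentiable ℂ (fun z => DirichletCharacter.LFunction x.ψ⁻¹ (1 - z)) :=
    (DirichletCharacter.differentiable_LFunction hψ).comp
      ((differentiable_const _).sub differentiable_id)
  have hfun : (fun s => kfrak3Star c' χ x s * omegaW D s) = fun s =>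
      (DirichletCharacter.LFunction x.ψ⁻¹ (1 - s - beta1 c' D) * FpolyBar χ x (1 - s) *
        Bpoly χ x s * Gpoly χ x s * Nchar D (psiFn x) (s + beta2 c' D) *
        Nchar D (psiFn x) (s + beta3 c' D) * omegaW D s) /
        DirichletCharacter.LFunction x.ψ⁻¹ (1 - s) := by
    funext s; exact kfrak3Star_mul_omega_eq_div c' x s
  rw [hfun]
  exact (((differentiable_numerator3Star c' x) s).div (hden s) hL).differentiableWithinAt

end Holomorphy

/-! ## The size of `𝔨₃*(s,ψ)ω(s)` on the horizontal sides -/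

section EdgeBound

variable (c' : ℝ) {D : ℕ} [NeZero D] {χ : DirichletCharacter ℂ D} (x : Chr D)

/-- **The reflected integrand on the horizontal sides.** Let `ψ ∈ Ψ₁` with the zeros of
`L(s,ψ)L(s,ψχ)` in `Ω` on the line, `D ≥ 3`, `𝓛 ≥ 3`, `0 < α ≤ 1/6`, `|c′|α𝓛 ≤ 1`, and `s = u + it`
with `−½ ≤ u ≤ ½−α`, `|t − 2πt₀| ≤ 𝓛₁`, `t ≥ 1`. Then, reflecting through `L(w,ψ̄) = conj L(w̄,ψ)`,
`|𝔨₃*(s,ψ)ω(s)| ≤ [p(|t|+5)Z]·exp(C(1+log(1/α))(log p + log(|t|+4)))·D⁸·[K_ι(P+1)⁴]·D¹²·(P+1)²·(P+1)²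
 ·(√π/𝓛₂)exp(((u−½)² − (t−2πt₀)²)/(4𝓛₂²))`, `K_ι = (1+|ι₂|)(|ι₃|+|ι₄|)`, `C` the absolute constant
of `DirichletDisc.exp_neg_le_norm_LFunction` (applied at `1 − s̄`). [cite: Zhang2022LandauSiegel, §17 (17.7) p.97] -/
theorem norm_kfrak3Star_omega_le {C : ℝ}
    (hC : ∀ (q : ℕ) [NeZero q] (θ : DirichletCharacter ℂ q), θ ≠ 1 → ∀ t σ d : ℝ,
      1 / 2 ≤ σ → σ ≤ 2 → 0 < d → d ≤ 1 →
        (∀ ρ ∈ DirichletDisc.discZeros θ t, ∀ y ∈ Icc σ 2, d ≤ ‖(y : ℂ) + t * I - ρ‖) →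
          Real.exp (-(C * (1 + Real.log (1 / d)) * (Real.log q + Real.log (|t| + 4)))) ≤
            ‖θ.LFunction ((σ : ℂ) + t * I)‖)
    (h22 : ∀ s ∈ prodZeroSetOmega χ x, s.re = 1 / 2) (hD : 3 ≤ D) (hℓ : 3 ≤ ell D)
    (hα0 : 0 < alpha D) (hα : alpha D ≤ 1 / 6) (hc : |c'| * (alpha D * ell D) ≤ 1)
    {u t : ℝ} (hu1 : -(1 / 2) ≤ u) (hu2 : u ≤ 1 / 2 - alpha D) (ht : |t - 2 * π * t0 D| ≤ ell1 D)
    (ht1 : 1 ≤ t) :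
    ‖kfrak3Star c' χ x ((u : ℂ) + t * I) * omegaW D ((u : ℂ) + t * I)‖ ≤
      ((x.p : ℝ) * (|t| + 5) * DirichletDisc.Zc) *
        Real.exp (C * (1 + Real.log (1 / alpha D)) * (Real.log x.p + Real.log (|t| + 4))) *
        (D : ℝ) ^ 8 * ((1 + ‖iota2‖) * (‖iota3‖ + ‖iota4‖) * (bigP D + 1) ^ 4) * (D : ℝ) ^ 12 *
        (bigP D + 1) ^ 2 * (bigP D + 1) ^ 2 *
        (Real.sqrt π / ell2 D * Real.exp (((u - 1 / 2) ^ 2 - (t - 2 * π * t0 D) ^ 2) /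
          (4 * ell2 D ^ 2))) := by
  set s : ℂ := (u : ℂ) + t * I with hs
  have hsre : s.re = u := by simp [hs]
  have hsim : s.im = t := by simp [hs]
  have hp0 : (0 : ℝ) < x.p := by exact_mod_cast x.prime.pos
  have hlog2 : 2 ≤ Real.log D := le_trans (by norm_num) hℓ
  have hZc : 1 ≤ DirichletDisc.Zc := DirichletDisc.one_le_Zc
  obtain ⟨hb1, -, -⟩ := Step8u016.abs_b_le_one c' hα0.le hα hc
  obtain ⟨e1, -, -⟩ := beta_eq_b_mul_I c' D
  -- the reflected point `w = 1 − s̄ = (1 − u) + it`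
  set w : ℂ := ((1 - u : ℝ) : ℂ) + t * I with hw
  have hwre : w.re = 1 - u := by simp [hw]
  have hwim : w.im = t := by simp [hw]
  have hconj1 : (starRingEnd ℂ) (1 - s) = w := by
    apply Complex.ext <;> simp [hs, hw]
  have hconj2 : (starRingEnd ℂ) (1 - s - beta1 c' D) = w + (b1 c' D : ℂ) * I := by
    rw [e1]; apply Complex.ext <;> simp [hs, hw]
  -- `|L(1−s−β₁,ψ̄)| = |L(w + ib₁, ψ)| ≤ p(|t|+5)Z`
  have hreI : w.re ∈ Icc (1 / 2 : ℝ) 2 := by rw [hwre]; constructor <;> linarith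
  have hL1 : ‖DirichletCharacter.LFunction x.ψ⁻¹ (1 - s - beta1 c' D)‖ ≤
      x.p * (|t| + 5) * DirichletDisc.Zc := by
    rw [Typed.Section13.LFunction_inv_conj x, Complex.norm_conj, hconj2, ← hwim]
    exact Step8u016.norm_LFunction_shift_le x hreI hb1
  -- the lower bound for `L(1−s,ψ̄) = conj L(w,ψ)`: disc zeros on the line, `≥ α` from `[1−u, 2] + it`
  have hα1 : alpha D ≤ 1 := by linarith
  have hdist := DirichletDisc.dist_segment_of_re_le (χ := x.ψ) (t := t) (σ := 1 - u) (d := alpha D)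
    (fun ρ hρ => by rw [Step8u016.discZeros_re_eq_half h22 ht ρ hρ]; linarith)
  have hLlow := hC x.p x.ψ x.ψ_ne_one t (1 - u) (alpha D) (by linarith) (by linarith) hα0 hα1 hdist
  set E : ℝ := Real.exp (C * (1 + Real.log (1 / alpha D)) * (Real.log x.p + Real.log (|t| + 4)))
    with hE
  have hE0 : 0 < E := Real.exp_pos _
  have hLweq : ‖DirichletCharacter.LFunction x.ψ⁻¹ (1 - s)‖ = ‖x.ψ.LFunction (((1 - u : ℝ) : ℂ) + t * I)‖ := by
    rw [Typed.Section13.LFunction_inv_conj x, Complex.norm_conj, hconj1]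
  have hLs0 : 0 < ‖DirichletCharacter.LFunction x.ψ⁻¹ (1 - s)‖ := by
    rw [hLweq]; exact lt_of_lt_of_le (Real.exp_pos _) hLlow
  have hF4 : ‖(DirichletCharacter.LFunction x.ψ⁻¹ (1 - s))⁻¹‖ ≤ E := by
    rw [norm_inv, inv_le_comm₀ hLs0 hE0, hE, ← Real.exp_neg, hLweq]
    exact hLlow
  -- the Dirichlet polynomials
  have hsre1 : -1 ≤ s.re := by rw [hsre]; linarith
  have hF : ‖FpolyBar χ x (1 - s)‖ ≤ (D : ℝ) ^ 8 :=
    Section4.norm_FpolyBar_le χ x (by simp only [sub_re, one_re, hsre]; linarith)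
  have hB : ‖Bpoly χ x s‖ ≤ (1 + ‖iota2‖) * (‖iota3‖ + ‖iota4‖) * (bigP D + 1) ^ 4 :=
    norm_Bpoly_le_left χ x hlog2 hsre1
  have hG : ‖Gpoly χ x s‖ ≤ (D : ℝ) ^ 12 := norm_Gpoly_le_left χ x hsre1
  obtain ⟨hre2, hre3⟩ := Eq172.re_add_beta23 c' (D := D) s
  have hN2 : ‖Nchar D (psiFn x) (s + beta2 c' D)‖ ≤ (bigP D + 1) ^ 2 :=
    norm_Nchar_le_left x hℓ (by rw [hre2]; exact hsre1)
  have hN3 : ‖Nchar D (psiFn x) (s + beta3 c' D)‖ ≤ (bigP D + 1) ^ 2 :=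
    norm_Nchar_le_left x hℓ (by rw [hre3]; exact hsre1)
  -- the weight
  have hℓ2 : 0 < ell2 D := pow_pos (by linarith) _
  have hω : ‖omegaW D s‖ = Real.sqrt π / ell2 D *
      Real.exp (((u - 1 / 2) ^ 2 - (t - 2 * π * t0 D) ^ 2) / (4 * ell2 D ^ 2)) := by
    have hs' : s = ((u - 1 / 2 : ℝ) : ℂ) + SmoothWeight.s0 (t0 D) + ((t - 2 * π * t0 D : ℝ) : ℂ) * I := by
      rw [hs, SmoothWeight.s0_def]; push_cast; ring
    rw [omegaW, hs', SmoothWeight.norm_omega_segment_eq hℓ2]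
  -- assembly
  have hfun : kfrak3Star c' χ x s * omegaW D s =
      DirichletCharacter.LFunction x.ψ⁻¹ (1 - s - beta1 c' D) *
        (DirichletCharacter.LFunction x.ψ⁻¹ (1 - s))⁻¹ * FpolyBar χ x (1 - s) * Bpoly χ x s *
        Gpoly χ x s * Nchar D (psiFn x) (s + beta2 c' D) * Nchar D (psiFn x) (s + beta3 c' D) *
        omegaW D s := by
    rw [kfrak3Star, div_eq_mul_inv]
  rw [hfun, norm_mul, norm_mul, norm_mul, norm_mul, norm_mul, norm_mul, norm_mul, hω]
  have hPZ : 0 ≤ (x.p : ℝ) * (|t| + 5) * DirichletDisc.Zc :=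
    mul_nonneg (mul_nonneg hp0.le (by positivity)) (le_trans zero_le_one hZc)
  have hP1 : 0 ≤ bigP D + 1 := by have := Real.exp_pos (ell D ^ 9); rw [bigP]; linarith
  have hKι : 0 ≤ (1 + ‖iota2‖) * (‖iota3‖ + ‖iota4‖) * (bigP D + 1) ^ 4 := by positivity
  have hD8 : 0 ≤ (D : ℝ) ^ 8 := by positivity
  have hD12 : 0 ≤ (D : ℝ) ^ 12 := by positivity
  have hω0 : 0 ≤ Real.sqrt π / ell2 D *
      Real.exp (((u - 1 / 2) ^ 2 - (t - 2 * π * t0 D) ^ 2) / (4 * ell2 D ^ 2)) :=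
    mul_nonneg (div_nonneg (Real.sqrt_nonneg _) hℓ2.le) (Real.exp_pos _).le
  have g1 : ‖DirichletCharacter.LFunction x.ψ⁻¹ (1 - s - beta1 c' D)‖ *
      ‖(DirichletCharacter.LFunction x.ψ⁻¹ (1 - s))⁻¹‖ ≤
      ((x.p : ℝ) * (|t| + 5) * DirichletDisc.Zc) * E :=
    mul_le_mul hL1 hF4 (norm_nonneg _) hPZ
  have g2 := mul_le_mul g1 hF (norm_nonneg _) (mul_nonneg hPZ hE0.le)
  have g3 := mul_le_mul g2 hB (norm_nonneg _) (mul_nonneg (mul_nonneg hPZ hE0.le) hD8)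
  have g4 := mul_le_mul g3 hG (norm_nonneg _)
    (mul_nonneg (mul_nonneg (mul_nonneg hPZ hE0.le) hD8) hKι)
  have g5 := mul_le_mul g4 hN2 (norm_nonneg _)
    (mul_nonneg (mul_nonneg (mul_nonneg (mul_nonneg hPZ hE0.le) hD8) hKι) hD12)
  have g6 := mul_le_mul g5 hN3 (norm_nonneg _)
    (mul_nonneg (mul_nonneg (mul_nonneg (mul_nonneg (mul_nonneg hPZ hE0.le) hD8) hKι) hD12)
      (sq_nonneg _))
  have g7 := mul_le_mul_of_nonneg_right g6 hω0
  refine g7.trans (le_of_eq ?_)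
  ring

end EdgeBound

/-! ## The uniform bound on the horizontal sides and the move `𝔍(−α) → 𝔍(−1)` -/

section Assembly

variable (c' : ℝ) {D : ℕ} [NeZero D] {χ : DirichletCharacter ℂ D}

omit [NeZero D] in
/-- `D²⁰ ≤ P` for `𝓛 ≥ 3` (`D = e^{𝓛}`, `P = e^{𝓛⁹}`, `20𝓛 ≤ 𝓛⁹`). [cite: Zhang2022LandauSiegel, §2 (2.1), (2.6)] -/
theorem natCast_pow_20_le_bigP (hD : 3 ≤ D) (hℓ : 3 ≤ ell D) : (D : ℝ) ^ 20 ≤ bigP D := by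
  have hD0 : (0 : ℝ) < D := by exact_mod_cast lt_of_lt_of_le (by norm_num) hD
  have hDexp : (D : ℝ) = Real.exp (ell D) := by rw [ell, Real.exp_log hD0]
  rw [hDexp, bigP, ← Real.exp_nat_mul, Real.exp_le_exp]
  push_cast
  have h8 : (3 : ℝ) ^ 8 ≤ ell D ^ 8 := pow_le_pow_left₀ (by norm_num) hℓ 8
  have h9 : ell D ^ 9 = ell D ^ 8 * ell D := by ring
  rw [h9]
  nlinarith

set_option maxHeartbeats 400000 in
/-- **The reflected integrand on either horizontal side, uniformly in `ψ` and `u`**: with the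
hypotheses of `norm_kfrak3Star_omega_le` and `𝓛 ≥ 3`, `π|c′| ≤ 𝓛⁸`, on `s = u + i(2πt₀ ± 𝓛₁)`,
`−½ ≤ u ≤ ½−α`, `|𝔨₃*ω| ≤ K·P¹²·exp(3C𝓛⁹(1 + 9log𝓛))·e^{−𝓛¹⁰/4}`, `K = 39Z·K_ι·16·16·6` (`P¹¹ ≤ P¹²`).
[cite: Zhang2022LandauSiegel, §17 (17.7) p.97] -/
theorem norm_kfrak3Star_omega_le_uniform {C : ℝ} (hC0 : 0 < C)
    (hC : ∀ (q : ℕ) [NeZero q] (θ : DirichletCharacter ℂ q), θ ≠ 1 → ∀ t σ d : ℝ,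
      1 / 2 ≤ σ → σ ≤ 2 → 0 < d → d ≤ 1 →
        (∀ ρ ∈ DirichletDisc.discZeros θ t, ∀ y ∈ Icc σ 2, d ≤ ‖(y : ℂ) + t * I - ρ‖) →
          Real.exp (-(C * (1 + Real.log (1 / d)) * (Real.log q + Real.log (|t| + 4)))) ≤
            ‖θ.LFunction ((σ : ℂ) + t * I)‖)
    (x : Chr D) (h22 : ∀ s ∈ prodZeroSetOmega χ x, s.re = 1 / 2) (hD : 3 ≤ D) (hℓ : 3 ≤ ell D)
    (hc : π * |c'| ≤ ell D ^ 8)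
    {u : ℝ} (hu1 : 1 / 2 + -1 ≤ u) (hu2 : u ≤ 1 / 2 + -alpha D) {t : ℝ}
    (ht : t = 2 * π * t0 D + ell1 D ∨ t = 2 * π * t0 D - ell1 D) :
    ‖kfrak3Star c' χ x ((u : ℂ) + t * I) * omegaW D ((u : ℂ) + t * I)‖ ≤
      (39 * DirichletDisc.Zc * ((1 + ‖iota2‖) * (‖iota3‖ + ‖iota4‖)) * 16 * 16 * 6) * bigP D ^ 12 *
        Real.exp (3 * C * ell D ^ 9 * (1 + 9 * Real.log (ell D))) *
        Real.exp (-(ell D ^ 10) / 4) := by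
  obtain ⟨hα0, hα6, hα1⟩ := Step8u016.alpha_small hℓ
  obtain ⟨hwin, hℓ1t0, ht01, hℓ21, hℓ10⟩ := Step8u016.window_sizes hℓ
  have hcα := Step8u016.abs_c_mul_alpha_ell_le_one hℓ hc
  have hπ3 := Real.pi_gt_three
  have hπ4 := Real.pi_lt_four
  have hπt : π * t0 D ≤ 7 / 2 * t0 D :=
    mul_le_mul_of_nonneg_right (by linarith [Real.pi_lt_d2]) (by linarith)
  have hπt' : 3 * t0 D ≤ π * t0 D := mul_le_mul_of_nonneg_right hπ3.le (by linarith)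
  have htabs : |t - 2 * π * t0 D| ≤ ell1 D := by
    rcases ht with ht' | ht'
    · rw [ht', show 2 * π * t0 D + ell1 D - 2 * π * t0 D = ell1 D by ring, abs_of_nonneg hℓ10]
    · rw [ht', show 2 * π * t0 D - ell1 D - 2 * π * t0 D = -ell1 D by ring, abs_neg,
        abs_of_nonneg hℓ10]
  have ht1 : 1 ≤ t := by rcases ht with ht' | ht' <;> rw [ht'] <;> linarith
  have htle : |t| ≤ 8 * t0 D := by
    rw [abs_of_pos (by linarith)]
    rcases ht with ht' | ht' <;> rw [ht'] <;> linarith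
  -- sizes
  have hP0 : 0 < bigP D := Real.exp_pos _
  have hP1 : 1 ≤ bigP D := Real.one_le_exp (pow_nonneg (Real.log_natCast_nonneg D) 9)
  have hp3 := Step8u016.chr_p_le_three_bigP hℓ x
  have hp1 : (1 : ℝ) ≤ x.p := by exact_mod_cast x.prime.one_lt.le
  have ht0P := Step8u016.t0_le_bigP hℓ
  have hZ1 : 1 ≤ DirichletDisc.Zc := DirichletDisc.one_le_Zc
  have ht4 : |t| + 4 ≤ 12 * bigP D := by nlinarith
  set Kι : ℝ := (1 + ‖iota2‖) * (‖iota3‖ + ‖iota4‖) with hKι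
  have hKι0 : 0 ≤ Kι := by rw [hKι]; positivity
  -- factor 1: `p(|t|+5)Z ≤ 3P·13P·Z`
  have f1 : (x.p : ℝ) * (|t| + 5) * DirichletDisc.Zc ≤ 3 * bigP D * (13 * bigP D) * DirichletDisc.Zc := by
    apply mul_le_mul_of_nonneg_right _ (by linarith)
    exact mul_le_mul hp3 (by nlinarith) (by positivity) (by linarith)
  -- factor 2: the exponent
  have f2 : Real.exp (C * (1 + Real.log (1 / alpha D)) * (Real.log x.p + Real.log (|t| + 4))) ≤
      Real.exp (3 * C * ell D ^ 9 * (1 + 9 * Real.log (ell D))) := by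
    rw [Real.exp_le_exp, mul_assoc]
    have h := Step8u016.log_factor_le hℓ hp1 hp3 ht4
    calc C * ((1 + Real.log (1 / alpha D)) * (Real.log x.p + Real.log (|t| + 4)))
        ≤ C * ((1 + 9 * Real.log (ell D)) * (3 * ell D ^ 9)) := mul_le_mul_of_nonneg_left h hC0.le
      _ = 3 * C * ell D ^ 9 * (1 + 9 * Real.log (ell D)) := by ring
  -- factor 3 and 5: `D⁸·D¹² = D²⁰ ≤ P`
  have f35 : (D : ℝ) ^ 8 * (D : ℝ) ^ 12 ≤ bigP D := by
    rw [← pow_add]; exact natCast_pow_20_le_bigP hD hℓ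
  -- factor 4: `Kι(P+1)⁴ ≤ Kι·16P⁴`
  have hP14 : (bigP D + 1) ^ 2 ≤ 4 * bigP D ^ 2 := by nlinarith
  have hP44 : (bigP D + 1) ^ 4 ≤ 16 * bigP D ^ 4 := by
    have : (bigP D + 1) ^ 4 = ((bigP D + 1) ^ 2) ^ 2 := by ring
    rw [this]
    calc ((bigP D + 1) ^ 2) ^ 2 ≤ (4 * bigP D ^ 2) ^ 2 := pow_le_pow_left₀ (sq_nonneg _) hP14 2
      _ = 16 * bigP D ^ 4 := by ring
  have f4 : Kι * (bigP D + 1) ^ 4 ≤ Kι * (16 * bigP D ^ 4) := mul_le_mul_of_nonneg_left hP44 hKι0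
  -- factors 6, 7: `(P+1)² ≤ 4P²`; factor 8: the Gaussian (`(u−½)² ≤ 1`)
  have f8 : Real.sqrt π / ell2 D * Real.exp (((u - 1 / 2) ^ 2 - (t - 2 * π * t0 D) ^ 2) /
      (4 * ell2 D ^ 2)) ≤ 6 * Real.exp (-(ell D ^ 10) / 4) := by
    have hsq : (t - 2 * π * t0 D) ^ 2 = ell1 D ^ 2 := by
      rcases ht with ht' | ht' <;> rw [ht'] <;> ring
    rw [hsq]
    refine Step8u016.omega_edge_le hℓ ?_
    have h1 : -1 ≤ u - 1 / 2 := by linarith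
    have h2 : u - 1 / 2 ≤ 0 := by linarith
    nlinarith
  -- combine
  have hu1' : -(1 / 2 : ℝ) ≤ u := by linarith
  have hu2' : u ≤ 1 / 2 - alpha D := by linarith
  have hbase := norm_kfrak3Star_omega_le c' x hC h22 hD hℓ hα0 hα6 hcα hu1' hu2' htabs ht1
  refine hbase.trans ?_
  have h0f1 : 0 ≤ (x.p : ℝ) * (|t| + 5) * DirichletDisc.Zc := by positivity
  have h0f2 : 0 ≤ Real.exp (C * (1 + Real.log (1 / alpha D)) * (Real.log x.p + Real.log (|t| + 4))) :=
    (Real.exp_pos _).le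
  have h0f4 : 0 ≤ Kι * (bigP D + 1) ^ 4 := by positivity
  have h0ω : 0 ≤ Real.sqrt π / ell2 D * Real.exp (((u - 1 / 2) ^ 2 - (t - 2 * π * t0 D) ^ 2) /
      (4 * ell2 D ^ 2)) :=
    mul_nonneg (div_nonneg (Real.sqrt_nonneg _) (by linarith)) (Real.exp_pos _).le
  -- regroup the left side as (f1)(f2)(D⁸D¹²)(Kι(P+1)⁴)((P+1)²)((P+1)²)(gauss)
  have hregroup : (x.p : ℝ) * (|t| + 5) * DirichletDisc.Zc *
        Real.exp (C * (1 + Real.log (1 / alpha D)) * (Real.log x.p + Real.log (|t| + 4))) *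
        (D : ℝ) ^ 8 * ((1 + ‖iota2‖) * (‖iota3‖ + ‖iota4‖) * (bigP D + 1) ^ 4) * (D : ℝ) ^ 12 *
        (bigP D + 1) ^ 2 * (bigP D + 1) ^ 2 *
        (Real.sqrt π / ell2 D * Real.exp (((u - 1 / 2) ^ 2 - (t - 2 * π * t0 D) ^ 2) /
          (4 * ell2 D ^ 2))) =
      ((x.p : ℝ) * (|t| + 5) * DirichletDisc.Zc) *
        Real.exp (C * (1 + Real.log (1 / alpha D)) * (Real.log x.p + Real.log (|t| + 4))) *
        ((D : ℝ) ^ 8 * (D : ℝ) ^ 12) * (Kι * (bigP D + 1) ^ 4) * (bigP D + 1) ^ 2 *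
        (bigP D + 1) ^ 2 *
        (Real.sqrt π / ell2 D * Real.exp (((u - 1 / 2) ^ 2 - (t - 2 * π * t0 D) ^ 2) /
          (4 * ell2 D ^ 2))) := by rw [hKι]; ring
  rw [hregroup]
  calc ((x.p : ℝ) * (|t| + 5) * DirichletDisc.Zc) *
        Real.exp (C * (1 + Real.log (1 / alpha D)) * (Real.log x.p + Real.log (|t| + 4))) *
        ((D : ℝ) ^ 8 * (D : ℝ) ^ 12) * (Kι * (bigP D + 1) ^ 4) * (bigP D + 1) ^ 2 *
        (bigP D + 1) ^ 2 *
        (Real.sqrt π / ell2 D * Real.exp (((u - 1 / 2) ^ 2 - (t - 2 * π * t0 D) ^ 2) /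
          (4 * ell2 D ^ 2)))
      ≤ (3 * bigP D * (13 * bigP D) * DirichletDisc.Zc) *
        Real.exp (3 * C * ell D ^ 9 * (1 + 9 * Real.log (ell D))) *
        bigP D * (Kι * (16 * bigP D ^ 4)) * (4 * bigP D ^ 2) * (4 * bigP D ^ 2) *
        (6 * Real.exp (-(ell D ^ 10) / 4)) := by
        have e1 := mul_le_mul f1 f2 h0f2 (by positivity)
        have e2 := mul_le_mul e1 f35 (by positivity) (by positivity)
        have e3 := mul_le_mul e2 f4 h0f4 (by positivity)
        have e4 := mul_le_mul e3 hP14 (by positivity) (by positivity)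
        have e5 := mul_le_mul e4 hP14 (by positivity) (by positivity)
        exact mul_le_mul e5 f8 h0ω (by positivity)
    _ = (39 * DirichletDisc.Zc * Kι * 16 * 16 * 6) * bigP D ^ 11 *
        Real.exp (3 * C * ell D ^ 9 * (1 + 9 * Real.log (ell D))) *
        Real.exp (-(ell D ^ 10) / 4) := by ring
    _ ≤ (39 * DirichletDisc.Zc * Kι * 16 * 16 * 6) * bigP D ^ 12 *
        Real.exp (3 * C * ell D ^ 9 * (1 + 9 * Real.log (ell D))) *
        Real.exp (-(ell D ^ 10) / 4) := by
        have hK0 : 0 ≤ 39 * DirichletDisc.Zc * Kι * 16 * 16 * 6 := by positivity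
        have hP12 : bigP D ^ 11 ≤ bigP D ^ 12 := pow_le_pow_right₀ hP1 (by norm_num)
        have := mul_le_mul_of_nonneg_left hP12 hK0
        gcongr

/-- **`Z22:(17.7)`, first half, as an edge from Proposition 2.2 (i)**: if for `ψ ∈ Ψ₁` the zeros of
`L(s,ψ)L(s,ψχ)` in `Ω` lie on the critical line (`Skeleton.Prop22i`), then for every `c′`
"moving the segment `𝔍(−α)` to `𝔍(−1)`" in `Σ_{ψ∈Ψ₁}(p_ψt₀)^{β₂}(1/2πi)∫𝔨₃*(s,ψ)ω(s)ds` costs `O(ε)`: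
`‖Σ_{ψ∈Ψ₁}(p_ψt₀)^{β₂}(1/2πi)∫_{𝔍(−α)}𝔨₃*ω − Σ_{ψ∈Ψ₁}(p_ψt₀)^{β₂}(1/2πi)∫_{𝔍(−1)}𝔨₃*ω‖ ≤ 1·e^{−𝓛¹⁰/16}`
for all large `D` (Assumption (A) is carried, not used). Per `ψ`: Cauchy's theorem on
`[−½, ½−α]×[2πt₀−𝓛₁, 2πt₀+𝓛₁]` (`Section7aStatements.norm_intJ_sub_intJ_le`, `z₁ = −1`, `z₂ = −α`,
with `differentiableOn_kfrak3Star_omega`) leaves the two horizontal sides, each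
`≤ K P¹²e^{3C𝓛⁹(1+9log𝓛)}e^{−𝓛¹⁰/4}` pointwise (`norm_kfrak3Star_omega_le_uniform`); `|(p_ψt₀)^{β₂}| = 1`;
summing over `#Ψ₁ ≤ 𝔓 ≤ 4P²` and absorbing `P¹⁴e^{O(𝓛⁹log𝓛)}` into `e^{3𝓛¹⁰/16}`
(`Step8u016.growth_le`). [cite: Zhang2022LandauSiegel, §17 (17.7) p.97, tex L4785–L4789] -/
theorem eq17_7a_of_prop22i (h22 : Prop22i) (c' : ℝ) :
    ∃ c : ℝ, 0 < c ∧ ∃ C : ℝ, ForAllLarge fun D _ χ => AssumptionA D χ →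
      ‖(∑ x ∈ finsetOf (PsiOne χ), (((x.p : ℝ) * t0 D : ℝ) : ℂ) ^ beta2 c' D *
            Lemma81.segInt (t0 D) (ell1 D) (-(alpha D : ℂ))
              fun s => kfrak3Star c' χ x s * omegaW D s) -
          ∑ x ∈ finsetOf (PsiOne χ), (((x.p : ℝ) * t0 D : ℝ) : ℂ) ^ beta2 c' D *
            Lemma81.segInt (t0 D) (ell1 D) (-1) fun s => kfrak3Star c' χ x s * omegaW D s‖ ≤
        C * Real.exp (-c * ell D ^ 10) := by
  classical
  obtain ⟨C, hC0, hC⟩ := DirichletDisc.exp_neg_le_norm_LFunction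
  obtain ⟨D₁, h22'⟩ := h22
  obtain ⟨D₂, hfrakP⟩ := Step8u016.frakP_le_eventually
  -- the growth threshold on `𝓛`
  set K : ℝ := 39 * DirichletDisc.Zc * ((1 + ‖iota2‖) * (‖iota3‖ + ‖iota4‖)) * 16 * 16 * 6 with hK
  have hK0 : 0 ≤ K := by rw [hK]; have := DirichletDisc.one_le_Zc; positivity
  obtain ⟨D₃, hD₃f⟩ := Skeleton.exists_forall_le_ell
    (max 3 (max (π * |c'| + 1) (max (64 * (4 * K) + 1) ((8 * (14 + 57 * C)) ^ 2))))
  refine ⟨1 / 16, by norm_num, 1, max (max D₁ D₂) (max D₃ 3), fun D _ χ hD hq hp _ => ?_⟩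
  have hD₁ : D₁ ≤ D := le_trans (le_trans (le_max_left _ _) (le_max_left _ _)) hD
  have hD₂ : D₂ ≤ D := le_trans (le_trans (le_max_right _ _) (le_max_left _ _)) hD
  have hD₃ : D₃ ≤ D := le_trans (le_trans (le_max_left _ _) (le_max_right _ _)) hD
  have hD3 : 3 ≤ D := le_trans (le_trans (le_max_right _ _) (le_max_right _ _)) hD
  have hM := hD₃f D hD₃
  have hℓ3 : 3 ≤ ell D := le_trans (le_max_left _ _) hM
  have hℓc : π * |c'| + 1 ≤ ell D := le_trans (le_trans (le_max_left _ _) (le_max_right _ _)) hM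
  have hℓK : 64 * (4 * K) + 1 ≤ ell D :=
    le_trans (le_trans (le_trans (le_max_left _ _) (le_max_right _ _)) (le_max_right _ _)) hM
  have hℓA : (8 * (14 + 57 * C)) ^ 2 ≤ ell D :=
    le_trans (le_trans (le_trans (le_max_right _ _) (le_max_right _ _)) (le_max_right _ _)) hM
  have hℓ1 : 1 ≤ ell D := by linarith
  have hℓ0 : 0 < ell D := by linarith
  have h22D := h22' D χ hD₁ hq hp
  obtain ⟨hα0, hα6, hα1⟩ := Step8u016.alpha_small hℓ3
  obtain ⟨-, -, ht01, -, -⟩ := Step8u016.window_sizes hℓ3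
  have ht0pos : 0 < t0 D := by linarith
  have hc8 : π * |c'| ≤ ell D ^ 8 := by
    have : ell D ≤ ell D ^ 8 := by
      calc ell D = ell D ^ 1 := (pow_one _).symm
        _ ≤ ell D ^ 8 := pow_le_pow_right₀ hℓ1 (by norm_num)
    linarith
  -- the uniform side bound `Mval`
  set Mval : ℝ := K * bigP D ^ 12 * Real.exp (3 * C * ell D ^ 9 * (1 + 9 * Real.log (ell D))) *
    Real.exp (-(ell D ^ 10) / 4) with hMval
  have hMval0 : 0 ≤ Mval := by rw [hMval]; positivity
  -- the phase `|(pt₀)^{β₂}| = 1`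
  have hphase : ∀ x : Chr D, ‖(((x.p : ℝ) * t0 D : ℝ) : ℂ) ^ beta2 c' D‖ = 1 := by
    intro x
    have hp : (0 : ℝ) < (x.p : ℝ) * t0 D := mul_pos (by exact_mod_cast x.prime.pos) ht0pos
    rw [Complex.norm_cpow_eq_rpow_re_of_pos hp]
    have hre : (beta2 c' D).re = 0 := by simp [beta2]
    rw [hre, Real.rpow_zero]
  -- per character: `‖(pt₀)^{β₂}((1/2πi)∫_{𝔍(−α)} − (1/2πi)∫_{𝔍(−1)})‖ ≤ Mval`
  have hper : ∀ x ∈ finsetOf (PsiOne χ),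
      ‖(((x.p : ℝ) * t0 D : ℝ) : ℂ) ^ beta2 c' D *
            Lemma81.segInt (t0 D) (ell1 D) (-(alpha D : ℂ))
              (fun s => kfrak3Star c' χ x s * omegaW D s) -
          (((x.p : ℝ) * t0 D : ℝ) : ℂ) ^ beta2 c' D *
            Lemma81.segInt (t0 D) (ell1 D) (-1) (fun s => kfrak3Star c' χ x s * omegaW D s)‖ ≤
        Mval := by
    intro x hx
    have hx' : x ∈ PsiOne χ := mem_of_mem_finsetOf hx
    have h22x : ∀ s ∈ prodZeroSetOmega χ x, s.re = 1 / 2 := h22D x hx'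
    set F : ℂ → ℂ := fun s => kfrak3Star c' χ x s * omegaW D s with hF_def
    have hF := differentiableOn_kfrak3Star_omega c' x h22x hα0 hα1
    have hside : ∀ t : ℝ, (t = 2 * π * t0 D + ell1 D ∨ t = 2 * π * t0 D - ell1 D) →
        ∀ u ∈ Set.Icc (1 / 2 + -1) (1 / 2 + -alpha D), ‖F ((u : ℂ) + ((t : ℝ) : ℂ) * I)‖ ≤ Mval := by
      intro t ht u hu
      have h := norm_kfrak3Star_omega_le_uniform c' hC0 hC x h22x hD3 hℓ3 hc8 hu.1 hu.2 ht
      rw [hMval, hK]; exact h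
    have hmove := Section7aStatements.norm_intJ_sub_intJ_le D (z₁ := -1) (z₂ := -alpha D)
      (M₁ := Mval) (M₂ := Mval) (by linarith) hF (hside _ (Or.inl rfl)) (hside _ (Or.inr rfl))
    -- `segInt(−α) − segInt(−1) = (intJ(−α) − intJ(−1))/(2πi)`
    have hI : Lemma81.segInt (t0 D) (ell1 D) (-(alpha D : ℂ)) F -
        Lemma81.segInt (t0 D) (ell1 D) (-1) F =
        (Section7aStatements.intJ D (-alpha D) F - Section7aStatements.intJ D (-1) F) /
          (2 * π * I) := by
      rw [show (-(alpha D : ℂ)) = ((-alpha D : ℝ) : ℂ) by push_cast; ring,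
        show (-1 : ℂ) = ((-1 : ℝ) : ℂ) by norm_num, Step8u016.segInt_eq_intJ_div,
        Step8u016.segInt_eq_intJ_div, sub_div]
    have hnorm2 : ‖(2 : ℂ) * π * I‖ = 2 * π := by
      rw [norm_mul, norm_mul, Complex.norm_I, mul_one, Complex.norm_real, Real.norm_eq_abs,
        abs_of_pos Real.pi_pos]
      norm_num
    rw [← mul_sub, norm_mul, hphase x, one_mul, hI, norm_div, hnorm2]
    rw [div_le_iff₀ (by positivity)]
    calc ‖Section7aStatements.intJ D (-alpha D) F - Section7aStatements.intJ D (-1) F‖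
        ≤ (-alpha D - -1) * (Mval + Mval) := hmove
      _ ≤ 1 * (Mval + Mval) := by
          apply mul_le_mul_of_nonneg_right _ (by positivity); linarith
      _ ≤ Mval * (2 * π) := by nlinarith [Real.pi_gt_three]
  -- summing over `Ψ₁`
  have hsum : ‖(∑ x ∈ finsetOf (PsiOne χ), (((x.p : ℝ) * t0 D : ℝ) : ℂ) ^ beta2 c' D *
            Lemma81.segInt (t0 D) (ell1 D) (-(alpha D : ℂ))
              fun s => kfrak3Star c' χ x s * omegaW D s) -
          ∑ x ∈ finsetOf (PsiOne χ), (((x.p : ℝ) * t0 D : ℝ) : ℂ) ^ beta2 c' D *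
            Lemma81.segInt (t0 D) (ell1 D) (-1) fun s => kfrak3Star c' χ x s * omegaW D s‖ ≤
      (finsetOf (PsiOne χ)).card * Mval := by
    rw [← Finset.sum_sub_distrib]
    calc ‖∑ x ∈ finsetOf (PsiOne χ),
          ((((x.p : ℝ) * t0 D : ℝ) : ℂ) ^ beta2 c' D *
              Lemma81.segInt (t0 D) (ell1 D) (-(alpha D : ℂ))
                (fun s => kfrak3Star c' χ x s * omegaW D s) -
            (((x.p : ℝ) * t0 D : ℝ) : ℂ) ^ beta2 c' D *
              Lemma81.segInt (t0 D) (ell1 D) (-1) fun s => kfrak3Star c' χ x s * omegaW D s)‖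
        ≤ ∑ x ∈ finsetOf (PsiOne χ),
          ‖(((x.p : ℝ) * t0 D : ℝ) : ℂ) ^ beta2 c' D *
              Lemma81.segInt (t0 D) (ell1 D) (-(alpha D : ℂ))
                (fun s => kfrak3Star c' χ x s * omegaW D s) -
            (((x.p : ℝ) * t0 D : ℝ) : ℂ) ^ beta2 c' D *
              Lemma81.segInt (t0 D) (ell1 D) (-1) fun s => kfrak3Star c' χ x s * omegaW D s‖ :=
          norm_sum_le _ _
      _ ≤ ∑ x ∈ finsetOf (PsiOne χ), Mval := Finset.sum_le_sum hper
      _ = (finsetOf (PsiOne χ)).card * Mval := by rw [Finset.sum_const, nsmul_eq_mul]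
  have hcard : ((finsetOf (PsiOne χ)).card : ℝ) ≤ 4 * bigP D ^ 2 :=
    (Ded81Edge.card_finsetOf_psiOne_le_frakP χ).trans (hfrakP D hD₂ hℓ1)
  refine hsum.trans ((mul_le_mul_of_nonneg_right hcard hMval0).trans ?_)
  -- the final size estimate: `4P²·Mval ≤ e^{−𝓛¹⁰/16}`
  have hP : bigP D = Real.exp (ell D ^ 9) := rfl
  have hgrowth := Step8u016.growth_le hC0.le hℓ1 (by
    calc 8 * (14 + 57 * C) = Real.sqrt ((8 * (14 + 57 * C)) ^ 2) := by
          rw [Real.sqrt_sq (by positivity)]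
      _ ≤ Real.sqrt (ell D) := Real.sqrt_le_sqrt hℓA)
  -- `4K ≤ e^{𝓛¹⁰/16}`
  have hconst : 4 * K ≤ Real.exp (ell D ^ 10 / 16) := by
    have h2 : ell D ≤ ell D ^ 10 := by
      calc ell D = ell D ^ 1 := (pow_one _).symm
        _ ≤ ell D ^ 10 := pow_le_pow_right₀ hℓ1 (by norm_num)
    calc 4 * K ≤ ell D ^ 10 / 16 := by linarith
      _ ≤ ell D ^ 10 / 16 + 1 := by linarith
      _ ≤ Real.exp (ell D ^ 10 / 16) := Real.add_one_le_exp _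
  -- `P¹⁴ e^{3C𝓛⁹(1+9log𝓛)} ≤ e^{𝓛¹⁰/8}`
  have hP14 : bigP D ^ 14 = Real.exp (14 * ell D ^ 9) := by
    rw [hP, ← Real.exp_nat_mul]; norm_num
  have hmid : bigP D ^ 14 * Real.exp (3 * C * ell D ^ 9 * (1 + 9 * Real.log (ell D))) ≤
      Real.exp (ell D ^ 10 / 8) := by
    rw [hP14, ← Real.exp_add, Real.exp_le_exp]
    have : 14 * ell D ^ 9 + 3 * C * ell D ^ 9 * (1 + 9 * Real.log (ell D)) =
        (14 + 3 * C) * ell D ^ 9 + 27 * C * ell D ^ 9 * Real.log (ell D) := by ring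
    rw [this]; exact hgrowth
  have hfinal : 4 * bigP D ^ 2 * Mval ≤ 1 * Real.exp (-(1 / 16) * ell D ^ 10) := by
    have e : 4 * bigP D ^ 2 * Mval = (4 * K) *
        (bigP D ^ 14 * Real.exp (3 * C * ell D ^ 9 * (1 + 9 * Real.log (ell D)))) *
        Real.exp (-(ell D ^ 10) / 4) := by
      rw [hMval]; ring
    rw [e]
    have h1 := mul_le_mul hconst hmid (by positivity) (Real.exp_pos _).le
    have h2 := mul_le_mul_of_nonneg_right h1 (Real.exp_pos (-(ell D ^ 10) / 4)).le
    refine h2.trans (le_of_eq ?_)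
    rw [← Real.exp_add, ← Real.exp_add, one_mul]
    congr 1; ring
  exact hfinal

end Assembly

end Literature.NumberTheory.LFunctions.Zhang2022.Eq177

end
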